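import Summits.QuantumAdvantage.QuantumAdvantage.Theorems.SosSandwichPseudoBoundedAABooleanSigned
import Literature.Computability.Complexity.BooleanFourierGranularity
import HarnessLib

/-!
# Crux `PseudoBoundedAA` (stmt-QuantumAdvantage-15237, route SosSandwich) — granularity of signed Boolean data

Support file (`--supports stmt-QuantumAdvantage-15237`, helper; nothing here proves the crux or the summit).
Companion of `SosSandwichPseudoBoundedAABooleanSigned.lean` for the census question (item (3) of
CONTRACTION-CALIBRATION-15237: "are there `±1`-valued degree-`d` families with all weight on level `d` and `n ≫ d²`
equally influential variables?").  From O'Donnell's granularity (`Literature/…/BooleanFourierGranularity.lean`,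
Exercise 1.11(b): the Fourier coefficients of a `±1`-valued function of degree `≤ T` are integer multiples of
`2^{1−T}`), for every `±1`-valued real polynomial `g` of total degree `≤ T` (`T ≥ 1`):

* `influence_eq_zero_or_ge_of_sq_eq_one` — every variable has `Inf_k[g] = 0` or `Inf_k[g] ≥ 4^{2−T}`;
* `sum_influence_le_of_sq_eq_one` — `Σ_k Inf_k[g] ≤ 4T` (total influence `≤` degree, Parseval `Σ ĝ² = 1`);
* `card_influential_le_of_sq_eq_one` — hence at most `T · 4^{T−1}` variables are influential (a junta bound of
  Nisan–Szegedy type, with the constant the coefficient granularity gives; the tree's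
  `Literature/Computability/Complexity/NisanSzegedyJunta.lean` has the sharper `d · 2^{d−1}` of Nisan–Szegedy — via
  Schwartz–Zippel for `D_i f`, influences `≥ 2^{1−d}` — in the `KKL.influence` vocabulary; the present statement is
  the route's `MvPolynomial`/`influence` form and is not meant to compete with it);
* `topRow_eq_zero_or_ge_of_boolean_homogeneous` — on HOMOGENEOUS data (all weight on level `T`) every top row
  `Σ_{|S|=T, S∋k} ĝ(S)²` is `0` or `≥ 4^{1−T}`.

Reading for the census: a homogeneous `±1`-valued degree-`T` family has `n ≤ T·2^{T−1}` relevant variables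
(Nisan–Szegedy; `T·4^{T−1}` from granularity alone), each of influence `≥ 4^{2−T}` (tree normalisation), and
(`…BooleanSigned`) `maxₖ Inf_k ≥ Var/(8T³) = 1/(8T³)`; "equally influential" families therefore have
`T ≤ n ≤ 32T⁴` — the window `n ≫ T²` asked about is `T² ≪ n ≲ 32T⁴`, and it is irrelevant for a POLYNOMIAL
two-certificate bound (`K(T) = 32T³` always suffices there).

All proved; axioms `propext`, `Classical.choice`, `Quot.sound`.  Sources: R. O'Donnell, *Analysis of Boolean
Functions* (CUP 2014) Ex. 1.11, §2.2; N. Nisan, M. Szegedy, Comput. Complexity 4 (1994) Thm 1.2 (junta bound).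
-/

set_option linter.dupNamespace false

noncomputable section

namespace Summit.QuantumAdvantage.QuantumAdvantage.Theorems.SosSandwich

open Finset MvPolynomial
open Literature.Computability.Complexity Literature.Computability.QuantumComplexity
open Literature.Computability.Complexity.LowDegree

namespace BooleanSigned

variable {N : ℕ}

/-- Every variable of a `±1`-valued polynomial of total degree `≤ T` (`T ≥ 1`) has influence `0` or `≥ 4^{2−T}`
(tree normalisation `Inf_k[g] = 4 Σ_{S∋k} ĝ(S)²`). [cite: ODonnell2014, Exercise 1.11(b)] -/
theorem influence_eq_zero_or_ge_of_sq_eq_one {T : ℕ} (hT : 1 ≤ T) (g : MvPolynomial (Fin N) ℝ)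
    (hg : g.totalDegree ≤ T) (hbool : ∀ x, evalBool g x ^ 2 = 1) (k : Fin N) :
    influence k g = 0 ∨ (4 : ℝ) / (4 : ℝ) ^ (T - 1) ≤ influence k g :=
  influence_eq_zero_or_ge_of_signValued hT g hg (evalBool_eq_one_or_eq_neg_one hbool) k

/-- Total influence of a `±1`-valued polynomial of total degree `≤ T`: `Σ_k Inf_k[g] ≤ 4T`
(`Σ_k Inf_k = 4 Σ_S |S| ĝ(S)² ≤ 4T Σ_S ĝ(S)² = 4T`). [cite: ODonnell2014, §2.2] -/
theorem sum_influence_le_of_sq_eq_one {T : ℕ} (g : MvPolynomial (Fin N) ℝ) (hg : g.totalDegree ≤ T)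
    (hbool : ∀ x, evalBool g x ^ 2 = 1) : ∑ k, influence k g ≤ 4 * (T : ℝ) := by
  rw [sum_influence_eq]
  have hle : ∀ S : Finset (Fin N), (S.card : ℝ) * cubeFourierCoeff (evalBool g) S ^ 2 ≤
      T * cubeFourierCoeff (evalBool g) S ^ 2 := by
    intro S
    by_cases hS : T < S.card
    · rw [cubeFourierCoeff_evalBool_eq_zero hg hS]; simp
    · exact mul_le_mul_of_nonneg_right (by exact_mod_cast not_lt.1 hS) (sq_nonneg _)
  calc 4 * ∑ S : Finset (Fin N), (S.card : ℝ) * cubeFourierCoeff (evalBool g) S ^ 2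
      ≤ 4 * ∑ S : Finset (Fin N), (T : ℝ) * cubeFourierCoeff (evalBool g) S ^ 2 :=
        mul_le_mul_of_nonneg_left (Finset.sum_le_sum fun S _ => hle S) (by norm_num)
    _ = 4 * T * ∑ S, cubeFourierCoeff (evalBool g) S ^ 2 := by rw [← Finset.mul_sum, mul_assoc]
    _ = 4 * T := by rw [sum_sq_fourier_eq_one_of_sq_eq_one hbool, mul_one]

/-- Junta bound for `±1`-valued polynomials of degree `≤ T` (`T ≥ 1`) from granularity alone: at most `T · 4^{T−1}`
variables are influential (`n · 4^{2−T} ≤ Σ_k Inf_k ≤ 4T`).  The sharper Nisan–Szegedy bound `T · 2^{T−1}` is the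
tree's `NisanSzegedyJunta.lean` (KKL vocabulary). [cite: ODonnell2014, Exercise 1.11(b)]
[cite: NisanSzegedy1994, Thm 1.2 (junta bound, there with `d·2^{d−1}`)] -/
theorem card_influential_le_of_sq_eq_one {T : ℕ} (hT : 1 ≤ T) (g : MvPolynomial (Fin N) ℝ)
    (hg : g.totalDegree ≤ T) (hbool : ∀ x, evalBool g x ^ 2 = 1) :
    ((Finset.univ.filter (fun k : Fin N => influence k g ≠ 0)).card : ℝ) ≤ T * (4 : ℝ) ^ (T - 1) := by
  classical
  set F := Finset.univ.filter (fun k : Fin N => influence k g ≠ 0) with hF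
  have h4 : (0 : ℝ) < (4 : ℝ) ^ (T - 1) := by positivity
  have hlow : (F.card : ℝ) * ((4 : ℝ) / (4 : ℝ) ^ (T - 1)) ≤ ∑ k ∈ F, influence k g := by
    rw [← nsmul_eq_mul, ← Finset.sum_const]
    refine Finset.sum_le_sum fun k hk => ?_
    have hk' : influence k g ≠ 0 := (Finset.mem_filter.mp hk).2
    rcases influence_eq_zero_or_ge_of_sq_eq_one hT g hg hbool k with h | h
    · exact absurd h hk'
    · exact h
  have hsub : ∑ k ∈ F, influence k g ≤ ∑ k, influence k g :=
    Finset.sum_le_sum_of_subset_of_nonneg (Finset.subset_univ F) fun k _ _ => influence_nonneg k g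
  have htot := sum_influence_le_of_sq_eq_one g hg hbool
  have hchain : (F.card : ℝ) * ((4 : ℝ) / (4 : ℝ) ^ (T - 1)) ≤ 4 * T := hlow.trans (hsub.trans htot)
  rw [mul_div_assoc', div_le_iff₀ h4] at hchain
  nlinarith [hchain, h4]

/-- On HOMOGENEOUS `±1`-valued data of degree `T ≥ 1` (every non-zero coefficient on level `T`) each top row
`Σ_{|S|=T, S∋k} ĝ(S)²` is `0` or at least `4^{1−T}` (`Inf_k = 4 ·` top row there). [cite: ODonnell2014, Exercise 1.11(b)] -/
theorem topRow_eq_zero_or_ge_of_boolean_homogeneous {T : ℕ} (hT : 1 ≤ T) (g : MvPolynomial (Fin N) ℝ)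
    (hg : g.totalDegree ≤ T) (hbool : ∀ x, evalBool g x ^ 2 = 1)
    (hhom : ∀ S : Finset (Fin N), cubeFourierCoeff (evalBool g) S ≠ 0 → S.card = T) (k : Fin N) :
    ∑ S ∈ Finset.univ.filter (fun S : Finset (Fin N) => S.card = T ∧ k ∈ S), cubeFourierCoeff (evalBool g) S ^ 2 = 0 ∨
      (1 : ℝ) / (4 : ℝ) ^ (T - 1) ≤
        ∑ S ∈ Finset.univ.filter (fun S : Finset (Fin N) => S.card = T ∧ k ∈ S),
          cubeFourierCoeff (evalBool g) S ^ 2 := by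
  classical
  have hzero : ∀ S : Finset (Fin N), S.card ≠ T → cubeFourierCoeff (evalBool g) S ^ 2 = 0 := by
    intro S hS
    have : cubeFourierCoeff (evalBool g) S = 0 := by
      by_contra h
      exact hS (hhom S h)
    rw [this]; ring
  have hInf : influence k g = 4 * ∑ S ∈ Finset.univ.filter (fun S : Finset (Fin N) => S.card = T ∧ k ∈ S),
      cubeFourierCoeff (evalBool g) S ^ 2 := by
    rw [influence_eq_sum_sq_fourier]
    congr 1
    rw [Finset.sum_filter, Finset.sum_filter]
    refine Finset.sum_congr rfl fun S _ => ?_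
    by_cases hS : S.card = T
    · simp [hS]
    · have hz := hzero S hS
      by_cases hk : k ∈ S <;> simp [hS, hk, hz]
  rcases influence_eq_zero_or_ge_of_sq_eq_one hT g hg hbool k with h | h
  · left
    rw [hInf] at h
    linarith
  · right
    rw [hInf] at h
    have h4 : (0 : ℝ) < (4 : ℝ) ^ (T - 1) := by positivity
    rw [div_le_iff₀ h4] at h ⊢
    linarith

end BooleanSigned

end Summit.QuantumAdvantage.QuantumAdvantage.Theorems.SosSandwich

end
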